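import Summits.HodgeConjecture.CorCM.IrreducibleOddWeightsIsotypicContainers
import Summits.HodgeConjecture.CorCM.IrreducibleOddWeightsShadowModules
import HarnessLib

/-!
# Isotypic cells, IV: THE ISOTYPIC SPLITTING OF THE MEET — `S(p+q) = S(p) + S(q)` along any stable direct
# decomposition, and `S(w₀) ∩ S(w₁) = (S(p₀) ∩ S(p₁)) ⊕ (S(q₀) ∩ S(q₁))` along an ISOTYPIC CUT

COR-CM (cell `pub-hodgecm2`, binder seat `b16` gen 70, count-neutral claim ISOTYPIC SPLITTING OF THE DEFECT, file I4 —
abstract `G`-set level, in the lane's own language; theorems only, no definition, no named fact, no `sorry`).  NEW as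
stated, hence under `Summits/`.  HONEST FRAMING: linear algebra of translates of functions on finite `G`-sets (files
I1–I3); the consequence for the Kubota–Dodson rank of a pair of CM types — the DEFECT `dim Hg(A₀)+dim Hg(A₁)−dim Hg(A₀×A₁)
= dim(S(w₀) ∩ S(w₁))` (gen 68) is a SUM over isotypic classes — is drawn in files I5 ff.; `HC_CM` is neither used nor
asserted.

SETTING.  `G` acts on finite `Y₀, Y₁`; `S(w) = span{g ↦ w(g·y)} ≤ ℚ^G`; containers `𝒞_A = Σ_y Θ_y(A)` (file I3).  An
ISOTYPIC CUT of the pair of shadow modules: on each pivot `Y_κ` two finite families of stable irreducible constituents,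
the `A`-CLASS (`A⁰_j ≤ ℚ^{Y₀}`, `A¹_j ≤ ℚ^{Y₁}`) and the `B`-CLASS (`B⁰_k`, `B¹_k`), such that no non-zero
`A`-constituent EMBEDS equivariantly into a `B`-constituent (on the same or on the other pivot); the shadows decompose as
`w_κ = p_κ + q_κ` with `p_κ ∈ Σ_j A^κ_j`, `q_κ ∈ Σ_k B^κ_k`.

* §1 **THE SUM FORMULA** (`span_shadowCoeff_add_eq_sup_of_inf_eq_bot`): `P, Q ≤ ℚ^{Y}` stable with `P ⊓ Q = 0`,
  `p ∈ P`, `q ∈ Q` ⟹ **`S(p + q) = S(p) ⊔ S(q)`** (the equivariant projections of file I1 §5 carry `p + q` to `p` and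
  to `q`; gen 69 Q11's `S(a + a′) = S(a) ⊔ S(a′)` is the case «irreducible ⊕ line»).  No irreducibility.
* §2 **CLASSES DO NOT MEET ON THE MODULE SIDE** (`iSup_inf_iSup_eq_bot_of_forall_not_embed`): `(Σ_j A_j) ⊓ (Σ_k B_k) = 0`
  in `ℚ^{Y}` when no non-zero `A_j` embeds into a `B_k` (file I2, translates as operators).
* §3 The lattice step: `D ⊓ D′ = 0`, `U, Z ≤ D`, `U′, Z′ ≤ D′` ⟹ `(U ⊔ U′) ⊓ (Z ⊔ Z′) = (U ⊓ Z) ⊔ (U′ ⊓ Z′)`, a direct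
  sum; `S(p) ≤` the container sum of its class.
* §4 **THE ISOTYPIC SPLITTING** (`span_shadowCoeff_inf_eq_sup_of_cut`, `finrank_span_shadowCoeff_inf_eq_add_of_cut`):
  along an isotypic cut **`S(p₀+q₀) ∩ S(p₁+q₁) = (S(p₀) ∩ S(p₁)) ⊔ (S(q₀) ∩ S(q₁))`** and
  **`dim(S(w₀) ∩ S(w₁)) = dim(S(p₀) ∩ S(p₁)) + dim(S(q₀) ∩ S(q₁))`** — iterate to split the defect over all isotypic
  classes; a class met by only one side contributes `0`; a class with one constituent per side contributes `0` or its
  dimension (gen 69 Q3); file I5 quantises classes with multiplicities.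

## References

* [Serre1977] J.-P. Serre, *Linear Representations of Finite Groups*, GTM 42, §2.6 (canonical decomposition), §2.2.
* [Lang2002] S. Lang, *Algebra*, 3rd ed., XVII §2, XVII §3.
* [Gordon1999HodgeAVSurvey] B. B. Gordon, *A survey of the Hodge conjecture for abelian varieties*, §3 Theorem (proof),
  7.5–7.7.
-/

set_option autoImplicit false

noncomputable section

open scoped BigOperators Classical

universe u u' u'' u''' v' v'' w

namespace Summit.HodgeConjecture.CorCM.IrrOdd

variable {G : Type w} [Group G] {Y₀ : Type v'} [MulAction G Y₀] [Fintype Y₀]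
  {Y₁ : Type v''} [MulAction G Y₁] [Fintype Y₁]

/-! ### §1 The sum formula -/

/-- **THE SUM FORMULA.**  `P, Q ≤ ℚ^{Y}` stable with `P ⊓ Q = 0`, `p ∈ P`, `q ∈ Q` ⟹ `S(p + q) = S(p) ⊔ S(q)`: the
equivariant projection onto `P` along `Q` carries `p + q` to `p`, so `S(p) ≤ S(p+q)` (and symmetrically), while
`S(p+q) ≤ S(p) + S(q)` by linearity. [cite: Serre1977, §2.6] [cite: Gordon1999HodgeAVSurvey, §3 Theorem (proof)] -/
theorem span_shadowCoeff_add_eq_sup_of_inf_eq_bot {P Q : Submodule ℚ (Y₀ → ℚ)}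
    (hPst : ∀ (k : G) (a : Y₀ → ℚ), a ∈ P → (fun y => a (k • y)) ∈ P)
    (hQst : ∀ (k : G) (a : Y₀ → ℚ), a ∈ Q → (fun y => a (k • y)) ∈ Q) (hPQ : P ⊓ Q = ⊥)
    {p q : Y₀ → ℚ} (hp : p ∈ P) (hq : q ∈ Q) :
    Submodule.span ℚ (Set.range fun y : Y₀ => fun g : G => (p + q) (g • y)) =
      Submodule.span ℚ (Set.range fun y : Y₀ => fun g : G => p (g • y)) ⊔
        Submodule.span ℚ (Set.range fun y : Y₀ => fun g : G => q (g • y)) := by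
  -- the translates as a family of operators
  let T : G → (Y₀ → ℚ) →ₗ[ℚ] (Y₀ → ℚ) := fun k => LinearMap.funLeft ℚ ℚ (fun y : Y₀ => k • y)
  have hT : ∀ (k : G) (f : Y₀ → ℚ), T k f = fun y => f (k • y) := fun k f => rfl
  have hPst' : ∀ (k : G) (a : Y₀ → ℚ), a ∈ P → T k a ∈ P := fun k a ha => hPst k a ha
  have hQst' : ∀ (k : G) (a : Y₀ → ℚ), a ∈ Q → T k a ∈ Q := fun k a ha => hQst k a ha
  refine le_antisymm ?_ (sup_le ?_ ?_)
  · rw [Submodule.span_le]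
    rintro _ ⟨y, rfl⟩
    have hsplit : (fun g : G => (p + q) (g • y)) = (fun g : G => p (g • y)) + fun g : G => q (g • y) := by
      funext g
      simp
    show (fun g : G => (p + q) (g • y)) ∈ _
    rw [hsplit]
    exact Submodule.add_mem _ (Submodule.mem_sup_left (Submodule.subset_span ⟨y, rfl⟩))
      (Submodule.mem_sup_right (Submodule.subset_span ⟨y, rfl⟩))
  · obtain ⟨π, -, hπP, hπQ, -, hπeq⟩ := exists_proj_of_inf_eq_bot T hPst' hQst' hPQ
    have hπw : π (p + q) = p := by rw [map_add, hπP p hp, hπQ q hq, add_zero]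
    refine span_shadowCoeff_le_of_map π (fun k => ?_) hπw
    have hmem : p + q ∈ P ⊔ Q := Submodule.add_mem _ (Submodule.mem_sup_left hp) (Submodule.mem_sup_right hq)
    have h := hπeq k (p + q) hmem
    rw [hT, hT] at h
    exact h
  · obtain ⟨π, -, hπQ', hπP', -, hπeq⟩ := exists_proj_of_inf_eq_bot T hQst' hPst' (by rw [inf_comm]; exact hPQ)
    have hπw : π (p + q) = q := by rw [map_add, hπP' p hp, hπQ' q hq, zero_add]
    refine span_shadowCoeff_le_of_map π (fun k => ?_) hπw
    have hmem : p + q ∈ Q ⊔ P := Submodule.add_mem _ (Submodule.mem_sup_right hp) (Submodule.mem_sup_left hq)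
    have h := hπeq k (p + q) hmem
    rw [hT, hT] at h
    exact h

/-! ### §2 Classes do not meet on the module side -/

omit [Fintype Y₀] in
/-- **CLASSES DO NOT MEET ON THE MODULE SIDE**: `A_j`, `B_k ≤ ℚ^{Y}` finite families of stable irreducibles such that no
non-zero `A_j` embeds equivariantly into a `B_k` ⟹ `(Σ_j A_j) ⊓ (Σ_k B_k) = 0`. [cite: Serre1977, §2.6]
[cite: Lang2002, XVII §2] -/
theorem iSup_inf_iSup_eq_bot_of_forall_not_embed {J : Type u} {K : Type u''} [Fintype J] [Fintype K]
    {A : J → Submodule ℚ (Y₀ → ℚ)} {B : K → Submodule ℚ (Y₀ → ℚ)}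
    [∀ j, FiniteDimensional ℚ (A j)] [∀ k, FiniteDimensional ℚ (B k)]
    (hAst : ∀ (j : J) (k : G) (a : Y₀ → ℚ), a ∈ A j → (fun y => a (k • y)) ∈ A j)
    (hAirr : ∀ (j : J) (W : Submodule ℚ (Y₀ → ℚ)), W ≤ A j → W ≠ ⊥ →
      (∀ (k : G) (f : Y₀ → ℚ), f ∈ W → (fun y => f (k • y)) ∈ W) → W = A j)
    (hBst : ∀ (j : K) (k : G) (a : Y₀ → ℚ), a ∈ B j → (fun y => a (k • y)) ∈ B j)
    (hBirr : ∀ (j : K) (W : Submodule ℚ (Y₀ → ℚ)), W ≤ B j → W ≠ ⊥ →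
      (∀ (k : G) (f : Y₀ → ℚ), f ∈ W → (fun y => f (k • y)) ∈ W) → W = B j)
    (hAB : ∀ (j : J) (k : K) (L : (Y₀ → ℚ) →ₗ[ℚ] (Y₀ → ℚ)), A j ≠ ⊥ → (∀ a ∈ A j, L a ∈ B k) →
      (∀ a ∈ A j, L a = 0 → a = 0) → (∀ (g : G) (a : Y₀ → ℚ), a ∈ A j →
        L (fun y => a (g • y)) = fun y => L a (g • y)) → False) :
    (⨆ j, A j) ⊓ (⨆ k, B k) = ⊥ := by
  let T : G → (Y₀ → ℚ) →ₗ[ℚ] (Y₀ → ℚ) := fun k => LinearMap.funLeft ℚ ℚ (fun y : Y₀ => k • y)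
  refine iSup_inf_iSup_eq_bot_of_forall_not_iso T (fun j k a ha => hAst j k a ha)
    (fun j W hW hW0 hWst => hAirr j W hW hW0 fun k f hf => hWst k f hf) (fun j k a ha => hBst j k a ha)
    (fun j W hW hW0 hWst => hBirr j W hW hW0 fun k f hf => hWst k f hf) ?_
  intro j k hj P hP hPinj _ hPeq
  exact hAB j k P hj hP hPinj fun g a ha => hPeq g a ha

/-! ### §3 The lattice step and the container bound -/

/-- The lattice step: `D ⊓ D′ = 0`, `U, Z ≤ D`, `U′, Z′ ≤ D′` ⟹ `(U ⊔ U′) ⊓ (Z ⊔ Z′) = (U ⊓ Z) ⊔ (U′ ⊓ Z′)`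
(compare components of `u + u′ = z + z′`). [folklore] -/
theorem sup_inf_sup_eq_of_inf_eq_bot {M : Type u} [AddCommGroup M] [Module ℚ M] {D D' U U' Z Z' : Submodule ℚ M}
    (hDD' : D ⊓ D' = ⊥) (hU : U ≤ D) (hZ : Z ≤ D) (hU' : U' ≤ D') (hZ' : Z' ≤ D') :
    (U ⊔ U') ⊓ (Z ⊔ Z') = (U ⊓ Z) ⊔ (U' ⊓ Z') := by
  refine le_antisymm ?_ (sup_le (inf_le_inf le_sup_left le_sup_left) (inf_le_inf le_sup_right le_sup_right))
  intro x hx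
  obtain ⟨hx₁, hx₂⟩ := Submodule.mem_inf.1 hx
  obtain ⟨u, hu, u', hu', rfl⟩ := Submodule.mem_sup.1 hx₁
  obtain ⟨z, hz, z', hz', hzz'⟩ := Submodule.mem_sup.1 hx₂
  -- `u - z = z' - u' ∈ D ⊓ D' = 0`
  have hmem : u - z ∈ D ⊓ D' := by
    refine ⟨Submodule.sub_mem _ (hU hu) (hZ hz), ?_⟩
    have heq : u - z = z' - u' := by
      rw [sub_eq_sub_iff_add_eq_add, add_comm z' z, hzz']
    rw [heq]
    exact Submodule.sub_mem _ (hZ' hz') (hU' hu')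
  rw [hDD', Submodule.mem_bot, sub_eq_zero] at hmem
  subst hmem
  have hu'z' : u' = z' := add_left_cancel hzz'.symm
  subst hu'z'
  exact Submodule.add_mem _ (Submodule.mem_sup_left ⟨hu, hz⟩) (Submodule.mem_sup_right ⟨hu', hz'⟩)

/-- In the lattice step the two pieces are independent, so dimensions add. [folklore] -/
theorem finrank_sup_inf_sup_eq_add_of_inf_eq_bot {M : Type u} [AddCommGroup M] [Module ℚ M]
    {D D' U U' Z Z' : Submodule ℚ M} [FiniteDimensional ℚ U] [FiniteDimensional ℚ U']
    (hDD' : D ⊓ D' = ⊥) (hU : U ≤ D) (hZ : Z ≤ D) (hU' : U' ≤ D') (hZ' : Z' ≤ D') :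
    Module.finrank ℚ ↥((U ⊔ U') ⊓ (Z ⊔ Z')) = Module.finrank ℚ ↥(U ⊓ Z) + Module.finrank ℚ ↥(U' ⊓ Z') := by
  rw [sup_inf_sup_eq_of_inf_eq_bot hDD' hU hZ hU' hZ']
  haveI : FiniteDimensional ℚ ↥(U ⊓ Z) := Submodule.finiteDimensional_of_le (inf_le_left : U ⊓ Z ≤ U)
  haveI : FiniteDimensional ℚ ↥(U' ⊓ Z') := Submodule.finiteDimensional_of_le (inf_le_left : U' ⊓ Z' ≤ U')
  have h := Submodule.finrank_sup_add_finrank_inf_eq (U ⊓ Z) (U' ⊓ Z')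
  have h0 : (U ⊓ Z) ⊓ (U' ⊓ Z') = ⊥ := by
    rw [eq_bot_iff, ← hDD']
    exact inf_le_inf (inf_le_left.trans hU) (inf_le_left.trans hU')
  rw [h0, finrank_bot, add_zero] at h
  exact h

omit [Fintype Y₀] in
/-- `S(p)` lies in the container sum of its class: `p ∈ Σ_j A_j` ⟹ `S(p) ≤ Σ_j Σ_y Θ_y(A_j)`. [cite: Serre1977, §2.6] -/
theorem span_shadowCoeff_le_iSup_container_of_mem_iSup {J : Type u} {A : J → Submodule ℚ (Y₀ → ℚ)} {p : Y₀ → ℚ}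
    (hp : p ∈ ⨆ j, A j) :
    Submodule.span ℚ (Set.range fun y : Y₀ => fun g : G => p (g • y)) ≤
      ⨆ j, ⨆ y : Y₀, (A j).map (LinearMap.funLeft ℚ ℚ (fun g : G => g • y)) := by
  rw [Submodule.span_le]
  rintro _ ⟨y, rfl⟩
  have hmem : LinearMap.funLeft ℚ ℚ (fun g : G => g • y) p ∈
      (⨆ j, A j).map (LinearMap.funLeft ℚ ℚ (fun g : G => g • y)) := Submodule.mem_map_of_mem hp
  rw [Submodule.map_iSup] at hmem
  have hle : (⨆ j, (A j).map (LinearMap.funLeft ℚ ℚ (fun g : G => g • y))) ≤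
      ⨆ j, ⨆ y : Y₀, (A j).map (LinearMap.funLeft ℚ ℚ (fun g : G => g • y)) :=
    iSup_mono fun j => le_iSup (fun y' : Y₀ => (A j).map (LinearMap.funLeft ℚ ℚ (fun g : G => g • y'))) y
  exact hle hmem

/-! ### §4 The isotypic splitting of the meet -/

/-- **THE ISOTYPIC SPLITTING OF THE MEET.**  Along an isotypic cut (two classes `A`, `B` of stable irreducible
constituents on the pivots `Y₀`, `Y₁`; no non-zero `A`-constituent embeds equivariantly into a `B`-constituent) the
shadow-coefficient spaces of `w_κ = p_κ + q_κ` (`p_κ` in the `A`-class, `q_κ` in the `B`-class) meet CLASS BY CLASS: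
**`S(p₀ + q₀) ∩ S(p₁ + q₁) = (S(p₀) ∩ S(p₁)) ⊔ (S(q₀) ∩ S(q₁))`**. [cite: Serre1977, §2.6] [cite: Lang2002, XVII §3]
[cite: Gordon1999HodgeAVSurvey, §3 Theorem (proof), 7.5–7.7] -/
theorem span_shadowCoeff_inf_eq_sup_of_cut {J₀ : Type u} {J₁ : Type u'} {K₀ : Type u''} {K₁ : Type u'''}
    [Fintype J₀] [Fintype J₁] [Fintype K₀] [Fintype K₁]
    {A₀ : J₀ → Submodule ℚ (Y₀ → ℚ)} {A₁ : J₁ → Submodule ℚ (Y₁ → ℚ)}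
    {B₀ : K₀ → Submodule ℚ (Y₀ → ℚ)} {B₁ : K₁ → Submodule ℚ (Y₁ → ℚ)}
    (hA₀st : ∀ (j : J₀) (k : G) (a : Y₀ → ℚ), a ∈ A₀ j → (fun y => a (k • y)) ∈ A₀ j)
    (hA₀irr : ∀ (j : J₀) (W : Submodule ℚ (Y₀ → ℚ)), W ≤ A₀ j → W ≠ ⊥ →
      (∀ (k : G) (f : Y₀ → ℚ), f ∈ W → (fun y => f (k • y)) ∈ W) → W = A₀ j)
    (hA₁st : ∀ (j : J₁) (k : G) (a : Y₁ → ℚ), a ∈ A₁ j → (fun y => a (k • y)) ∈ A₁ j)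
    (hA₁irr : ∀ (j : J₁) (W : Submodule ℚ (Y₁ → ℚ)), W ≤ A₁ j → W ≠ ⊥ →
      (∀ (k : G) (f : Y₁ → ℚ), f ∈ W → (fun y => f (k • y)) ∈ W) → W = A₁ j)
    (hB₀st : ∀ (j : K₀) (k : G) (a : Y₀ → ℚ), a ∈ B₀ j → (fun y => a (k • y)) ∈ B₀ j)
    (hB₀irr : ∀ (j : K₀) (W : Submodule ℚ (Y₀ → ℚ)), W ≤ B₀ j → W ≠ ⊥ →
      (∀ (k : G) (f : Y₀ → ℚ), f ∈ W → (fun y => f (k • y)) ∈ W) → W = B₀ j)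
    (hB₁st : ∀ (j : K₁) (k : G) (a : Y₁ → ℚ), a ∈ B₁ j → (fun y => a (k • y)) ∈ B₁ j)
    (hB₁irr : ∀ (j : K₁) (W : Submodule ℚ (Y₁ → ℚ)), W ≤ B₁ j → W ≠ ⊥ →
      (∀ (k : G) (f : Y₁ → ℚ), f ∈ W → (fun y => f (k • y)) ∈ W) → W = B₁ j)
    (h₀₀ : ∀ (j : J₀) (k : K₀) (L : (Y₀ → ℚ) →ₗ[ℚ] (Y₀ → ℚ)), A₀ j ≠ ⊥ → (∀ a ∈ A₀ j, L a ∈ B₀ k) →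
      (∀ a ∈ A₀ j, L a = 0 → a = 0) → (∀ (g : G) (a : Y₀ → ℚ), a ∈ A₀ j →
        L (fun y => a (g • y)) = fun y => L a (g • y)) → False)
    (h₀₁ : ∀ (j : J₀) (k : K₁) (L : (Y₀ → ℚ) →ₗ[ℚ] (Y₁ → ℚ)), A₀ j ≠ ⊥ → (∀ a ∈ A₀ j, L a ∈ B₁ k) →
      (∀ a ∈ A₀ j, L a = 0 → a = 0) → (∀ (g : G) (a : Y₀ → ℚ), a ∈ A₀ j →
        L (fun y => a (g • y)) = fun y => L a (g • y)) → False)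
    (h₁₀ : ∀ (j : J₁) (k : K₀) (L : (Y₁ → ℚ) →ₗ[ℚ] (Y₀ → ℚ)), A₁ j ≠ ⊥ → (∀ a ∈ A₁ j, L a ∈ B₀ k) →
      (∀ a ∈ A₁ j, L a = 0 → a = 0) → (∀ (g : G) (a : Y₁ → ℚ), a ∈ A₁ j →
        L (fun y => a (g • y)) = fun y => L a (g • y)) → False)
    (h₁₁ : ∀ (j : J₁) (k : K₁) (L : (Y₁ → ℚ) →ₗ[ℚ] (Y₁ → ℚ)), A₁ j ≠ ⊥ → (∀ a ∈ A₁ j, L a ∈ B₁ k) →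
      (∀ a ∈ A₁ j, L a = 0 → a = 0) → (∀ (g : G) (a : Y₁ → ℚ), a ∈ A₁ j →
        L (fun y => a (g • y)) = fun y => L a (g • y)) → False)
    {p₀ q₀ : Y₀ → ℚ} {p₁ q₁ : Y₁ → ℚ} (hp₀ : p₀ ∈ ⨆ j, A₀ j) (hq₀ : q₀ ∈ ⨆ k, B₀ k)
    (hp₁ : p₁ ∈ ⨆ j, A₁ j) (hq₁ : q₁ ∈ ⨆ k, B₁ k) :
    Submodule.span ℚ (Set.range fun y : Y₀ => fun g : G => (p₀ + q₀) (g • y)) ⊓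
        Submodule.span ℚ (Set.range fun y : Y₁ => fun g : G => (p₁ + q₁) (g • y)) =
      (Submodule.span ℚ (Set.range fun y : Y₀ => fun g : G => p₀ (g • y)) ⊓
          Submodule.span ℚ (Set.range fun y : Y₁ => fun g : G => p₁ (g • y))) ⊔
        (Submodule.span ℚ (Set.range fun y : Y₀ => fun g : G => q₀ (g • y)) ⊓
          Submodule.span ℚ (Set.range fun y : Y₁ => fun g : G => q₁ (g • y))) := by
  haveI : ∀ j, FiniteDimensional ℚ (A₀ j) := fun j => Submodule.finiteDimensional_of_le le_top
  haveI : ∀ k, FiniteDimensional ℚ (B₀ k) := fun k => Submodule.finiteDimensional_of_le le_top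
  haveI : ∀ j, FiniteDimensional ℚ (A₁ j) := fun j => Submodule.finiteDimensional_of_le le_top
  haveI : ∀ k, FiniteDimensional ℚ (B₁ k) := fun k => Submodule.finiteDimensional_of_le le_top
  -- the classes do not meet on the module side, so the sum formula applies on each pivot
  have hPQ₀ : (⨆ j, A₀ j) ⊓ (⨆ k, B₀ k) = ⊥ :=
    iSup_inf_iSup_eq_bot_of_forall_not_embed hA₀st hA₀irr hB₀st hB₀irr h₀₀
  have hPQ₁ : (⨆ j, A₁ j) ⊓ (⨆ k, B₁ k) = ⊥ :=
    iSup_inf_iSup_eq_bot_of_forall_not_embed hA₁st hA₁irr hB₁st hB₁irr h₁₁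
  let T₀ : G → (Y₀ → ℚ) →ₗ[ℚ] (Y₀ → ℚ) := fun k => LinearMap.funLeft ℚ ℚ (fun y : Y₀ => k • y)
  let T₁ : G → (Y₁ → ℚ) →ₗ[ℚ] (Y₁ → ℚ) := fun k => LinearMap.funLeft ℚ ℚ (fun y : Y₁ => k • y)
  have hP₀st := stable_iSup T₀ A₀ (fun j k a ha => hA₀st j k a ha)
  have hQ₀st := stable_iSup T₀ B₀ (fun j k a ha => hB₀st j k a ha)
  have hP₁st := stable_iSup T₁ A₁ (fun j k a ha => hA₁st j k a ha)
  have hQ₁st := stable_iSup T₁ B₁ (fun j k a ha => hB₁st j k a ha)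
  rw [span_shadowCoeff_add_eq_sup_of_inf_eq_bot (fun k a ha => hP₀st k a ha) (fun k a ha => hQ₀st k a ha) hPQ₀
      hp₀ hq₀,
    span_shadowCoeff_add_eq_sup_of_inf_eq_bot (fun k a ha => hP₁st k a ha) (fun k a ha => hQ₁st k a ha) hPQ₁
      hp₁ hq₁]
  -- the container sums of the two classes meet trivially in `ℚ^G`
  have hDD' := iSup_container_inf_iSup_container_eq_bot hA₀st hA₀irr hA₁st hA₁irr hB₀st hB₀irr hB₁st hB₁irr
    h₀₀ h₀₁ h₁₀ h₁₁
  exact sup_inf_sup_eq_of_inf_eq_bot hDD'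
    ((span_shadowCoeff_le_iSup_container_of_mem_iSup hp₀).trans le_sup_left)
    ((span_shadowCoeff_le_iSup_container_of_mem_iSup hp₁).trans le_sup_right)
    ((span_shadowCoeff_le_iSup_container_of_mem_iSup hq₀).trans le_sup_left)
    ((span_shadowCoeff_le_iSup_container_of_mem_iSup hq₁).trans le_sup_right)

/-- **THE DEFECT SPLITS OVER THE CUT**: `dim(S(p₀+q₀) ∩ S(p₁+q₁)) = dim(S(p₀) ∩ S(p₁)) + dim(S(q₀) ∩ S(q₁))`.
[cite: Serre1977, §2.6] [cite: Gordon1999HodgeAVSurvey, §3 Theorem (proof), 7.5–7.7] -/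
theorem finrank_span_shadowCoeff_inf_eq_add_of_cut {J₀ : Type u} {J₁ : Type u'} {K₀ : Type u''} {K₁ : Type u'''}
    [Fintype J₀] [Fintype J₁] [Fintype K₀] [Fintype K₁]
    {A₀ : J₀ → Submodule ℚ (Y₀ → ℚ)} {A₁ : J₁ → Submodule ℚ (Y₁ → ℚ)}
    {B₀ : K₀ → Submodule ℚ (Y₀ → ℚ)} {B₁ : K₁ → Submodule ℚ (Y₁ → ℚ)}
    (hA₀st : ∀ (j : J₀) (k : G) (a : Y₀ → ℚ), a ∈ A₀ j → (fun y => a (k • y)) ∈ A₀ j)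
    (hA₀irr : ∀ (j : J₀) (W : Submodule ℚ (Y₀ → ℚ)), W ≤ A₀ j → W ≠ ⊥ →
      (∀ (k : G) (f : Y₀ → ℚ), f ∈ W → (fun y => f (k • y)) ∈ W) → W = A₀ j)
    (hA₁st : ∀ (j : J₁) (k : G) (a : Y₁ → ℚ), a ∈ A₁ j → (fun y => a (k • y)) ∈ A₁ j)
    (hA₁irr : ∀ (j : J₁) (W : Submodule ℚ (Y₁ → ℚ)), W ≤ A₁ j → W ≠ ⊥ →
      (∀ (k : G) (f : Y₁ → ℚ), f ∈ W → (fun y => f (k • y)) ∈ W) → W = A₁ j)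
    (hB₀st : ∀ (j : K₀) (k : G) (a : Y₀ → ℚ), a ∈ B₀ j → (fun y => a (k • y)) ∈ B₀ j)
    (hB₀irr : ∀ (j : K₀) (W : Submodule ℚ (Y₀ → ℚ)), W ≤ B₀ j → W ≠ ⊥ →
      (∀ (k : G) (f : Y₀ → ℚ), f ∈ W → (fun y => f (k • y)) ∈ W) → W = B₀ j)
    (hB₁st : ∀ (j : K₁) (k : G) (a : Y₁ → ℚ), a ∈ B₁ j → (fun y => a (k • y)) ∈ B₁ j)
    (hB₁irr : ∀ (j : K₁) (W : Submodule ℚ (Y₁ → ℚ)), W ≤ B₁ j → W ≠ ⊥ →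
      (∀ (k : G) (f : Y₁ → ℚ), f ∈ W → (fun y => f (k • y)) ∈ W) → W = B₁ j)
    (h₀₀ : ∀ (j : J₀) (k : K₀) (L : (Y₀ → ℚ) →ₗ[ℚ] (Y₀ → ℚ)), A₀ j ≠ ⊥ → (∀ a ∈ A₀ j, L a ∈ B₀ k) →
      (∀ a ∈ A₀ j, L a = 0 → a = 0) → (∀ (g : G) (a : Y₀ → ℚ), a ∈ A₀ j →
        L (fun y => a (g • y)) = fun y => L a (g • y)) → False)
    (h₀₁ : ∀ (j : J₀) (k : K₁) (L : (Y₀ → ℚ) →ₗ[ℚ] (Y₁ → ℚ)), A₀ j ≠ ⊥ → (∀ a ∈ A₀ j, L a ∈ B₁ k) →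
      (∀ a ∈ A₀ j, L a = 0 → a = 0) → (∀ (g : G) (a : Y₀ → ℚ), a ∈ A₀ j →
        L (fun y => a (g • y)) = fun y => L a (g • y)) → False)
    (h₁₀ : ∀ (j : J₁) (k : K₀) (L : (Y₁ → ℚ) →ₗ[ℚ] (Y₀ → ℚ)), A₁ j ≠ ⊥ → (∀ a ∈ A₁ j, L a ∈ B₀ k) →
      (∀ a ∈ A₁ j, L a = 0 → a = 0) → (∀ (g : G) (a : Y₁ → ℚ), a ∈ A₁ j →
        L (fun y => a (g • y)) = fun y => L a (g • y)) → False)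
    (h₁₁ : ∀ (j : J₁) (k : K₁) (L : (Y₁ → ℚ) →ₗ[ℚ] (Y₁ → ℚ)), A₁ j ≠ ⊥ → (∀ a ∈ A₁ j, L a ∈ B₁ k) →
      (∀ a ∈ A₁ j, L a = 0 → a = 0) → (∀ (g : G) (a : Y₁ → ℚ), a ∈ A₁ j →
        L (fun y => a (g • y)) = fun y => L a (g • y)) → False)
    {p₀ q₀ : Y₀ → ℚ} {p₁ q₁ : Y₁ → ℚ} (hp₀ : p₀ ∈ ⨆ j, A₀ j) (hq₀ : q₀ ∈ ⨆ k, B₀ k)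
    (hp₁ : p₁ ∈ ⨆ j, A₁ j) (hq₁ : q₁ ∈ ⨆ k, B₁ k) :
    Module.finrank ℚ ↥(Submodule.span ℚ (Set.range fun y : Y₀ => fun g : G => (p₀ + q₀) (g • y)) ⊓
        Submodule.span ℚ (Set.range fun y : Y₁ => fun g : G => (p₁ + q₁) (g • y))) =
      Module.finrank ℚ ↥(Submodule.span ℚ (Set.range fun y : Y₀ => fun g : G => p₀ (g • y)) ⊓
          Submodule.span ℚ (Set.range fun y : Y₁ => fun g : G => p₁ (g • y))) +
        Module.finrank ℚ ↥(Submodule.span ℚ (Set.range fun y : Y₀ => fun g : G => q₀ (g • y)) ⊓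
          Submodule.span ℚ (Set.range fun y : Y₁ => fun g : G => q₁ (g • y))) := by
  haveI : ∀ j, FiniteDimensional ℚ (A₀ j) := fun j => Submodule.finiteDimensional_of_le le_top
  haveI : ∀ k, FiniteDimensional ℚ (B₀ k) := fun k => Submodule.finiteDimensional_of_le le_top
  haveI : ∀ j, FiniteDimensional ℚ (A₁ j) := fun j => Submodule.finiteDimensional_of_le le_top
  haveI : ∀ k, FiniteDimensional ℚ (B₁ k) := fun k => Submodule.finiteDimensional_of_le le_top
  have hPQ₀ : (⨆ j, A₀ j) ⊓ (⨆ k, B₀ k) = ⊥ :=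
    iSup_inf_iSup_eq_bot_of_forall_not_embed hA₀st hA₀irr hB₀st hB₀irr h₀₀
  have hPQ₁ : (⨆ j, A₁ j) ⊓ (⨆ k, B₁ k) = ⊥ :=
    iSup_inf_iSup_eq_bot_of_forall_not_embed hA₁st hA₁irr hB₁st hB₁irr h₁₁
  let T₀ : G → (Y₀ → ℚ) →ₗ[ℚ] (Y₀ → ℚ) := fun k => LinearMap.funLeft ℚ ℚ (fun y : Y₀ => k • y)
  let T₁ : G → (Y₁ → ℚ) →ₗ[ℚ] (Y₁ → ℚ) := fun k => LinearMap.funLeft ℚ ℚ (fun y : Y₁ => k • y)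
  have hP₀st := stable_iSup T₀ A₀ (fun j k a ha => hA₀st j k a ha)
  have hQ₀st := stable_iSup T₀ B₀ (fun j k a ha => hB₀st j k a ha)
  have hP₁st := stable_iSup T₁ A₁ (fun j k a ha => hA₁st j k a ha)
  have hQ₁st := stable_iSup T₁ B₁ (fun j k a ha => hB₁st j k a ha)
  rw [span_shadowCoeff_add_eq_sup_of_inf_eq_bot (fun k a ha => hP₀st k a ha) (fun k a ha => hQ₀st k a ha) hPQ₀
      hp₀ hq₀,
    span_shadowCoeff_add_eq_sup_of_inf_eq_bot (fun k a ha => hP₁st k a ha) (fun k a ha => hQ₁st k a ha) hPQ₁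
      hp₁ hq₁]
  have hDD' := iSup_container_inf_iSup_container_eq_bot hA₀st hA₀irr hA₁st hA₁irr hB₀st hB₀irr hB₁st hB₁irr
    h₀₀ h₀₁ h₁₀ h₁₁
  haveI : FiniteDimensional ℚ ↥(Submodule.span ℚ (Set.range fun y : Y₀ => fun g : G => p₀ (g • y))) :=
    FiniteDimensional.span_of_finite ℚ (Set.finite_range _)
  haveI : FiniteDimensional ℚ ↥(Submodule.span ℚ (Set.range fun y : Y₀ => fun g : G => q₀ (g • y))) :=
    FiniteDimensional.span_of_finite ℚ (Set.finite_range _)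
  exact finrank_sup_inf_sup_eq_add_of_inf_eq_bot hDD'
    ((span_shadowCoeff_le_iSup_container_of_mem_iSup hp₀).trans le_sup_left)
    ((span_shadowCoeff_le_iSup_container_of_mem_iSup hp₁).trans le_sup_right)
    ((span_shadowCoeff_le_iSup_container_of_mem_iSup hq₀).trans le_sup_left)
    ((span_shadowCoeff_le_iSup_container_of_mem_iSup hq₁).trans le_sup_right)

end Summit.HodgeConjecture.CorCM.IrrOdd

end
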